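import Mathlib
import Literature.Analysis.ValidatedNumerics.WeightedWienerAlgebra
import Literature.Analysis.ValidatedNumerics.ConeMonomialLaplacian
import HarnessLib

/-!
# Evaluation of the cone algebra `ℓ¹_ϱ(ζ^a ζ̄^b)` on the closed unit disk is a bounded algebra homomorphism

Topic `Literature/Analysis/ValidatedNumerics`.  The semantics of a coefficient-space certificate: an
element `u = Σ u_{ab} ζ^a ζ̄^b` of the cone Wiener algebra `W = WienerAlgebra.Wiener (coneSubmultWeight hϱ)`
(`ϱ ≥ 1`; `WeightedWienerAlgebra.lean`) defines, at every point `ζ` of the closed unit disk, the absolutely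
convergent sum `eval u ζ = Σ_{(a,b)} u_{ab} ζ^a ζ̄^b ∈ ℂ` (basis functions = `ConeMonomial.monomial a b`
of `ConeMonomialLaplacian.lean`), and

* `norm_eval_le` — **`|u(ζ)| ≤ ‖u‖_ϱ`** for `|ζ| ≤ 1` (each `|ζ^aζ̄^b| ≤ 1 ≤ ϱ^{a+b}`); hence the POINT ROWS
  of a certificate: `‖u − ū‖_ϱ ≤ r ⇒ |u(ζ) − ū(ζ)| ≤ r` (`norm_eval_sub_le`);
* `eval_mul` — **`(u·v)(ζ) = u(ζ)·v(ζ)`**: the Cauchy product of the algebra IS the pointwise product of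
  the represented functions (Cauchy product formula for absolutely convergent series), with `eval_one`,
  `eval_add`, `eval_smul`: `evalAlgHom ζ : W →ₐ[ℝ] ℂ` — so an identity `F(u) = 0` proved in `W`
  (e.g. the zero found by `ConeSemilinear.cone_existsUnique_zero_of_semilin`) holds pointwise on the
  closed disk for the represented functions.

## Sources

[ArioliKoch2019] G. Arioli, H. Koch, Nonlinear Anal. 179 (2019) §3: (3.1)–(3.2) (functions on the disk
as weighted absolutely summable series; "`B_ρ` is the subspace of real-valued functions `u ∈ A_ρ`"),
Lemma 3.1 ("`A_ρ` is a Banach algebra under pointwise multiplication … If `ρ > 1` then the functions in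
`A_ρ` extend analytically to some complex open neighborhood of `Ω`") — here the plain-monomial version and
only the closed-disk `C⁰` statements; [HungriaLessardMirelesJames2016] (1.2) p. 1429 / §2.1 (the
`ν`-weighted norm dominates the sup norm of the represented function on the unit polydisk).

## What is NOT covered

Differentiability of `ζ ↦ eval u ζ` and the termwise Laplacian (that `eval ∘ Δ_D⁻¹` inverts `Δ` with zero
boundary values — `ConeMonomial.lapRI_monomial` / `monomial_boundary` give it column by column); analytic
extension beyond the closed disk; real-valuedness bookkeeping for symmetric families; any float model.

## Provenance

AI-produced formalisation (cell certnum, seat certnum-ode-2, 2026-08-27): the `C⁰` function-value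
dictionary behind the point rows of the F2 (B″)/(B-SL) deliveries.
-/

set_option autoImplicit false

open scoped BigOperators
open Complex

noncomputable section

namespace Literature.Analysis.ValidatedNumerics

namespace ConeEval

open WeightedSeq WienerAlgebra ConeMonomial

/-- The basis function of exponent `n = (a,b)`: `ζ^a ζ̄^b` (= `ConeMonomial.monomial a b ζ`).
[cite: ArioliKoch2019, §3 eq. (3.1) (expansion in the disk basis)] -/
def mono (n : Fin 2 →₀ ℕ) (ζ : ℂ) : ℂ := monomial (n 0) (n 1) ζ

/-- [cite: ArioliKoch2019, §3 eq. (3.1)] -/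
theorem mono_eq (n : Fin 2 →₀ ℕ) (ζ : ℂ) : mono n ζ = ζ ^ (n 0) * (starRingEnd ℂ ζ) ^ (n 1) := rfl

/-- `ζ^0 ζ̄^0 = 1`. [cite: ArioliKoch2019, §3 eq. (3.1)] -/
theorem mono_zero (ζ : ℂ) : mono 0 ζ = 1 := by simp [mono_eq]

/-- Multiplicativity of the basis: `ζ^{a+a'} ζ̄^{b+b'} = (ζ^a ζ̄^b)(ζ^{a'} ζ̄^{b'})` — the reason the Cauchy
product of coefficient families is the pointwise product of functions.
[cite: ArioliKoch2019, §3 eq. (3.4) (product of basis functions; monomial case)] -/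
theorem mono_add (p q : Fin 2 →₀ ℕ) (ζ : ℂ) : mono (p + q) ζ = mono p ζ * mono q ζ := by
  simp only [mono_eq, Finsupp.coe_add, Pi.add_apply, pow_add]
  ring

/-- `|ζ^a ζ̄^b| = |ζ|^{a+b}`. [cite: ArioliKoch2019, §3 eq. (3.2) (weight ρ^{degree})] -/
theorem norm_mono (n : Fin 2 →₀ ℕ) (ζ : ℂ) : ‖mono n ζ‖ = ‖ζ‖ ^ (n 0 + n 1) := by
  rw [mono_eq, norm_mul, norm_pow, norm_pow, Complex.norm_conj, pow_add]

/-- On the closed unit disk the basis is dominated by the cone weight: `|ζ^aζ̄^b| ≤ 1 ≤ ϱ^{a+b}`.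
[cite: ArioliKoch2019, §3 eq. (3.2); HungriaLessardMirelesJames2016 (1.2) p. 1429] -/
theorem norm_mono_le_weight {ϱ : ℝ} (hϱ : 1 ≤ ϱ) (n : Fin 2 →₀ ℕ) {ζ : ℂ} (hζ : ‖ζ‖ ≤ 1) :
    ‖mono n ζ‖ ≤ (coneSubmultWeight hϱ).toFun n := by
  rw [norm_mono, coneSubmultWeight_apply]
  exact (pow_le_one₀ (norm_nonneg _) hζ).trans (one_le_pow₀ hϱ)

variable {ϱ : ℝ}

/-- The (real) coefficient `u_{ab}` of `u ∈ W` at the exponent `n = (a,b)`.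
[cite: ArioliKoch2019, §3 eq. (3.1)] -/
def cf {hϱ : 1 ≤ ϱ} (u : Wiener (coneSubmultWeight hϱ)) (n : Fin 2 →₀ ℕ) : ℝ :=
  MvPowerSeries.coeff n (u : MvPowerSeries (Fin 2) ℝ)

/-- [cite: ArioliKoch2019, §3 eq. (3.1)] -/
theorem cf_eq_coeffFun {hϱ : 1 ≤ ϱ} (u : Wiener (coneSubmultWeight hϱ)) :
    cf u = coeffFun (u : MvPowerSeries (Fin 2) ℝ) := rfl

/-- The coefficient family of `u ∈ W` is in `ℓ¹_ω`. [cite: ArioliKoch2019, §3 eq. (3.2)] -/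
theorem mem_cf {hϱ : 1 ≤ ϱ} (u : Wiener (coneSubmultWeight hϱ)) : Mem (coneSubmultWeight hϱ).toFun (cf u) :=
  Wiener.coeffFun_mem u

/-- `‖u‖ = Σ |u_n| ω(n)`. [cite: ArioliKoch2019, §3 eq. (3.2)] -/
theorem norm_eq_wnorm_cf {hϱ : 1 ≤ ϱ} (u : Wiener (coneSubmultWeight hϱ)) :
    ‖u‖ = wnorm (coneSubmultWeight hϱ).toFun (cf u) := Wiener.norm_def u

/-- [cite: ArioliKoch2019, §3 eq. (3.1)] -/
theorem cf_add {hϱ : 1 ≤ ϱ} (u v : Wiener (coneSubmultWeight hϱ)) (n : Fin 2 →₀ ℕ) :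
    cf (u + v) n = cf u n + cf v n := by
  unfold cf; rw [Subalgebra.coe_add, map_add]

/-- [cite: ArioliKoch2019, §3 eq. (3.1)] -/
theorem cf_smul {hϱ : 1 ≤ ϱ} (r : ℝ) (u : Wiener (coneSubmultWeight hϱ)) (n : Fin 2 →₀ ℕ) :
    cf (r • u) n = r * cf u n := by
  unfold cf; rw [Subalgebra.coe_smul, MvPowerSeries.coeff_smul]

/-- [cite: ArioliKoch2019, §3 eq. (3.1)] -/
theorem cf_one {hϱ : 1 ≤ ϱ} (n : Fin 2 →₀ ℕ) :
    cf (1 : Wiener (coneSubmultWeight hϱ)) n = if n = 0 then 1 else 0 := by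
  classical
  unfold cf; rw [Subalgebra.coe_one, MvPowerSeries.coeff_one]

/-- The Cauchy product coefficientwise. [cite: ArioliKoch2019, §3 eq. (3.4) (product formula)] -/
theorem cf_mul {hϱ : 1 ≤ ϱ} (u v : Wiener (coneSubmultWeight hϱ)) (n : Fin 2 →₀ ℕ) :
    cf (u * v) n = ∑ kl ∈ Finset.HasAntidiagonal.antidiagonal n, cf u kl.1 * cf v kl.2 := by
  classical
  unfold cf; rw [Subalgebra.coe_mul, MvPowerSeries.coeff_mul]

/-- **Evaluation** of `u ∈ W = ℓ¹_ϱ(ζ^aζ̄^b)` at `ζ`: `u(ζ) = Σ_{(a,b)} u_{ab} ζ^a ζ̄^b`.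
[cite: ArioliKoch2019, §3 eq. (3.1)] -/
def eval (hϱ : 1 ≤ ϱ) (u : Wiener (coneSubmultWeight hϱ)) (ζ : ℂ) : ℂ :=
  ∑' n, (cf u n : ℂ) * mono n ζ

/-- The terms of `u(ζ)` are dominated by the weighted coefficient family (`|ζ| ≤ 1`).
[cite: ArioliKoch2019, §3 eq. (3.2)] -/
theorem norm_term_le (hϱ : 1 ≤ ϱ) (u : Wiener (coneSubmultWeight hϱ)) {ζ : ℂ} (hζ : ‖ζ‖ ≤ 1)
    (n : Fin 2 →₀ ℕ) :
    ‖(cf u n : ℂ) * mono n ζ‖ ≤ |cf u n| * (coneSubmultWeight hϱ).toFun n := by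
  rw [norm_mul, Complex.norm_real, Real.norm_eq_abs]
  exact mul_le_mul_of_nonneg_left (norm_mono_le_weight hϱ n hζ) (abs_nonneg _)

/-- Absolute convergence of `u(ζ)` on the closed unit disk.
[cite: ArioliKoch2019, §3 eq. (3.1)–(3.2) (finite norm ⇒ the series defines the function)] -/
theorem summable_term (hϱ : 1 ≤ ϱ) (u : Wiener (coneSubmultWeight hϱ)) {ζ : ℂ} (hζ : ‖ζ‖ ≤ 1) :
    Summable fun n => (cf u n : ℂ) * mono n ζ :=
  Summable.of_norm_bounded (mem_cf u) (norm_term_le hϱ u hζ)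

/-- Summability of the norms (used for the Cauchy product). [cite: ArioliKoch2019, §3 eq. (3.2)] -/
theorem summable_norm_term (hϱ : 1 ≤ ϱ) (u : Wiener (coneSubmultWeight hϱ)) {ζ : ℂ} (hζ : ‖ζ‖ ≤ 1) :
    Summable fun n => ‖(cf u n : ℂ) * mono n ζ‖ :=
  Summable.of_nonneg_of_le (fun _ => norm_nonneg _) (norm_term_le hϱ u hζ) (mem_cf u)

/-- **`|u(ζ)| ≤ ‖u‖_ϱ`** on the closed unit disk.
[cite: ArioliKoch2019, §3 eq. (3.2); HungriaLessardMirelesJames2016 (1.2) p. 1429 (ν-norm dominates the sup norm)] -/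
theorem norm_eval_le (hϱ : 1 ≤ ϱ) (u : Wiener (coneSubmultWeight hϱ)) {ζ : ℂ} (hζ : ‖ζ‖ ≤ 1) :
    ‖eval hϱ u ζ‖ ≤ ‖u‖ := by
  rw [norm_eq_wnorm_cf]
  exact tsum_of_norm_bounded (mem_cf u).hasSum (norm_term_le hϱ u hζ)

/-- Evaluation is additive. [cite: ArioliKoch2019, §3 eq. (3.1)] -/
theorem eval_add (hϱ : 1 ≤ ϱ) (u v : Wiener (coneSubmultWeight hϱ)) {ζ : ℂ} (hζ : ‖ζ‖ ≤ 1) :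
    eval hϱ (u + v) ζ = eval hϱ u ζ + eval hϱ v ζ := by
  unfold eval
  rw [← (summable_term hϱ u hζ).tsum_add (summable_term hϱ v hζ)]
  refine tsum_congr fun n => ?_
  rw [cf_add, Complex.ofReal_add, add_mul]

/-- Evaluation is `ℝ`-homogeneous. [cite: ArioliKoch2019, §3 eq. (3.1)] -/
theorem eval_smul (hϱ : 1 ≤ ϱ) (r : ℝ) (u : Wiener (coneSubmultWeight hϱ)) (ζ : ℂ) :
    eval hϱ (r • u) ζ = (r : ℂ) * eval hϱ u ζ := by
  unfold eval
  rw [← tsum_mul_left]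
  refine tsum_congr fun n => ?_
  rw [cf_smul, Complex.ofReal_mul, mul_assoc]

/-- `1(ζ) = 1`. [cite: ArioliKoch2019, §3 eq. (3.1)] -/
theorem eval_one (hϱ : 1 ≤ ϱ) (ζ : ℂ) : eval hϱ 1 ζ = 1 := by
  unfold eval
  rw [tsum_eq_single 0]
  · rw [cf_one, if_pos rfl, mono_zero]; simp
  · intro n hn
    rw [cf_one, if_neg hn]; simp

/-- Constants evaluate to themselves: `(r·1)(ζ) = r`. [cite: ArioliKoch2019, §3 eq. (3.1)] -/
theorem eval_algebraMap (hϱ : 1 ≤ ϱ) (r : ℝ) (ζ : ℂ) :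
    eval hϱ (algebraMap ℝ (Wiener (coneSubmultWeight hϱ)) r) ζ = (r : ℂ) := by
  rw [Algebra.algebraMap_eq_smul_one, eval_smul, eval_one, mul_one]

/-- **`(u·v)(ζ) = u(ζ)·v(ζ)`**: the Cauchy product of the cone algebra is the pointwise product of the
represented functions (`|ζ| ≤ 1`; Cauchy product formula for absolutely convergent series over the
exponent monoid `ℕ²`, and `ζ^{p+q}… = (ζ^p…)(ζ^q…)`).
[cite: ArioliKoch2019, §3 Lemma 3.1 (Banach algebra under POINTWISE multiplication) and eq. (3.4)] -/
theorem eval_mul (hϱ : 1 ≤ ϱ) (u v : Wiener (coneSubmultWeight hϱ)) {ζ : ℂ} (hζ : ‖ζ‖ ≤ 1) :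
    eval hϱ (u * v) ζ = eval hϱ u ζ * eval hϱ v ζ := by
  classical
  set f : (Fin 2 →₀ ℕ) → ℂ := fun n => (cf u n : ℂ) * mono n ζ with hf
  set g : (Fin 2 →₀ ℕ) → ℂ := fun n => (cf v n : ℂ) * mono n ζ with hg
  have hfs : Summable f := summable_term hϱ u hζ
  have hgs : Summable g := summable_term hϱ v hζ
  have hfg : Summable fun x : (Fin 2 →₀ ℕ) × (Fin 2 →₀ ℕ) => f x.1 * g x.2 :=
    summable_mul_of_summable_norm (summable_norm_term hϱ u hζ) (summable_norm_term hϱ v hζ)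
  have hprod : eval hϱ u ζ * eval hϱ v ζ
      = ∑' n, ∑ kl ∈ Finset.HasAntidiagonal.antidiagonal n, f kl.1 * g kl.2 := by
    unfold eval
    exact hfs.tsum_mul_tsum_eq_tsum_sum_antidiagonal hgs hfg
  rw [hprod]
  unfold eval
  refine tsum_congr fun n => ?_
  rw [cf_mul, Complex.ofReal_sum, Finset.sum_mul]
  refine Finset.sum_congr rfl fun kl hkl => ?_
  rw [Finset.HasAntidiagonal.mem_antidiagonal] at hkl
  rw [hf, hg]
  simp only
  rw [← hkl, mono_add, Complex.ofReal_mul]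
  ring

/-- **Evaluation at a point of the closed unit disk is an `ℝ`-algebra homomorphism `W →ₐ[ℝ] ℂ`.**
[cite: ArioliKoch2019, §3 Lemma 3.1 (pointwise multiplication) and eq. (3.1)] -/
def evalAlgHom (hϱ : 1 ≤ ϱ) {ζ : ℂ} (hζ : ‖ζ‖ ≤ 1) : Wiener (coneSubmultWeight hϱ) →ₐ[ℝ] ℂ where
  toFun u := eval hϱ u ζ
  map_one' := eval_one hϱ ζ
  map_mul' u v := eval_mul hϱ u v hζ
  map_zero' := by
    have h := eval_smul hϱ 0 (1 : Wiener (coneSubmultWeight hϱ)) ζ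
    rw [zero_smul, Complex.ofReal_zero, zero_mul] at h
    exact h
  map_add' u v := eval_add hϱ u v hζ
  commutes' r := eval_algebraMap hϱ r ζ

/-- [cite: ArioliKoch2019, §3 eq. (3.1)] -/
@[simp] theorem evalAlgHom_apply (hϱ : 1 ≤ ϱ) {ζ : ℂ} (hζ : ‖ζ‖ ≤ 1) (u : Wiener (coneSubmultWeight hϱ)) :
    evalAlgHom hϱ hζ u = eval hϱ u ζ := rfl

/-- **Point rows of a certificate:** `‖u − ū‖_ϱ ≤ r ⇒ |u(ζ) − ū(ζ)| ≤ r` for `|ζ| ≤ 1` — the certified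
ball in `W` is a uniform ball for the represented functions on the closed unit disk.
[cite: ArioliKoch2019, §4 Lemma 4.1 ("within a distance ‖A‖δ of ū") with §3 eq. (3.2); HungriaLessardMirelesJames2016 (1.2) p. 1429] -/
theorem norm_eval_sub_le (hϱ : 1 ≤ ϱ) {u ubar : Wiener (coneSubmultWeight hϱ)} {r : ℝ}
    (h : ‖u - ubar‖ ≤ r) {ζ : ℂ} (hζ : ‖ζ‖ ≤ 1) :
    ‖eval hϱ u ζ - eval hϱ ubar ζ‖ ≤ r := by
  have e : eval hϱ u ζ - eval hϱ ubar ζ = eval hϱ (u - ubar) ζ := by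
    rw [← evalAlgHom_apply hϱ hζ, ← evalAlgHom_apply hϱ hζ, ← evalAlgHom_apply hϱ hζ, map_sub]
  rw [e]
  exact (norm_eval_le hϱ _ hζ).trans h

/-- **An equation in `W` holds pointwise:** if `Φ u = 0` in `W` for an expression `Φ u` built from `u` by
the algebra operations, then its evaluation vanishes at every point of the closed disk; in particular a
zero `x⋆` of `F(x) = x − L(v x + Σ c_k x^k) − g` satisfies `x⋆(ζ) = (L(v x⋆ + Σ c_k x⋆^k))(ζ) + g(ζ)` with
`(v x⋆ + Σ c_k x⋆^k)(ζ) = v(ζ) x⋆(ζ) + Σ c_k(ζ) x⋆(ζ)^k`.  Stated here as the general transport lemma.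
[cite: ArioliKoch2019, §3 Lemma 3.1 with eq. (1.4) (p. 4) and §4 Lemma 4.1 (pp. 9–10) (fixed points of G are solutions)] -/
theorem eval_eq_zero_of_eq_zero (hϱ : 1 ≤ ϱ) {w : Wiener (coneSubmultWeight hϱ)} (hw : w = 0)
    {ζ : ℂ} (hζ : ‖ζ‖ ≤ 1) : eval hϱ w ζ = 0 := by
  rw [hw, ← evalAlgHom_apply hϱ hζ, map_zero]

/-- Evaluation of a polynomial nonlinearity: `(Σ_{k≤m} c_k u^k)(ζ) = Σ_{k≤m} c_k(ζ) u(ζ)^k`.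
[cite: ArioliKoch2019, §3 Lemma 3.1 (pointwise multiplication)] -/
theorem eval_polyMap (hϱ : 1 ≤ ϱ) (c : ℕ → Wiener (coneSubmultWeight hϱ)) (m : ℕ)
    (u : Wiener (coneSubmultWeight hϱ)) {ζ : ℂ} (hζ : ‖ζ‖ ≤ 1) :
    eval hϱ (∑ k ∈ Finset.range (m + 1), c k * u ^ k) ζ
      = ∑ k ∈ Finset.range (m + 1), eval hϱ (c k) ζ * (eval hϱ u ζ) ^ k := by
  rw [← evalAlgHom_apply hϱ hζ, map_sum]
  refine Finset.sum_congr rfl fun k _ => ?_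
  rw [map_mul, map_pow, evalAlgHom_apply, evalAlgHom_apply]

end ConeEval

end Literature.Analysis.ValidatedNumerics
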